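import Summits.CriticalPhenomena.Ising3DConformalLimit.Theses.FKParityRobustness
import Summits.CriticalPhenomena.Ising3DConformalLimit.Theorems.FKParityRobustnessDefs
import Summits.CriticalPhenomena.Ising3DConformalLimit.Theorems.FKParityRobustnessParityRobustMergingFKTransfer
import Summits.CriticalPhenomena.Ising3DConformalLimit.Theorems.FKParityRobustnessIndependentStrandsJoinStubPerScaleAux
import Summits.CriticalPhenomena.Ising3DConformalLimit.Theorems.IndependentStrandsJoin.Negative.GraphUniform
import Literature.Probability.LatticeModels.LoopO1
import Literature.Probability.LatticeModels.ThermodynamicLimit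
import Literature.Combinatorics.SimpleGraph.CycleSpaceSeparators
import Mathlib.Combinatorics.SimpleGraph.Walk.Maps
import Mathlib.Combinatorics.SimpleGraph.Paths
import HarnessLib

/-!
# Crux `IndependentStrandsJoin` (stmt-CriticalPhenomena-14625), line `pinch-to-tetra` — stub
# `stub_perScale`: the PER-SCALE crux

Route `FKParityRobustness`, sub-problem `Ising3DConformalLimit`; support file (theorem-only) for the
line `pinch-to-tetra` of the crux `IndependentStrandsJoin`.

**What the stub says.**  For every scale `l ≥ 1` there is a constant `c(l) > 0` such that for all
boxes `Λ_N`, `N ≥ N₀(l)`, with `a = l • tetra` the tetrahedral sources, `G = G_N` the nearest-neighbour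
graph of the box and `t = tanh β_c(3)`,

  `c(l) · Z(a₀a₁) · Z(a₂a₃) ≤ Σ_{F₁ ∈ 𝒯(a₀a₁)} Σ_{F₂ ∈ 𝒯(a₂a₃)} t^{|F₁|+|F₂|} · 1[a₀ ↔ a₂ in F₁ ∪ F₂]`

— the crux with `∃ c` moved after `∀ l` (the crux itself is the `l`-uniformity of `c`).

**Proof** (finite energy, `c(l) = (t²/2)^{8l}`, `N₀ = l`).  Let `D` be a `T`-join of `{a₂, a₃}` in
`G_N` with `|D| ≤ 8l` inside which `a₀` is joined to `a₂` (`exists_forcingSet`: the XOR of the edge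
sets of two edge-disjoint simple lattice paths `a₂ → (-l,-l,l) → a₀` and `a₀ → (-l,l,-l) → a₃` of
`Λ_l ⊆ Λ_N`, built from straight legs `exists_leg`, lifted to the box graph `exists_lift`, made simple by
`Walk.bypass`; `forcingSet_of_paths`).  On `{F₂ ⊇ D}` the indicator is `1` for every `F₁`, so the
double sum is at least `Z(a₀a₁) · Σ_{F₂ ∈ 𝒯(a₂a₃), F₂ ⊇ D} t^{|F₂|} ≥ Z(a₀a₁) · (t²/2)^{|D|} Z(a₂a₃)` by
the forcing cost `t^{2|D|} Z_A ≤ 2^{|D|} Σ_{F ⊇ D} t^{|F|}` of the auxiliary file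
`…StubPerScaleAux.lean` (XOR transport + finite energy through the high-temperature expansion + the
forcing decomposition), and `(t²/2)^{|D|} ≥ (t²/2)^{8l}` as `t ≤ 1` — this general-graph assembly is
`StubPerScale.perScale_of_forcingSet` of the auxiliary file, registered there as the auxiliary stub
`stub_perScaleAssembly`.

References: U. T. Hansen, J. Jiang, F. R. Klausen, arXiv:2506.10765, §2 (sourced loop O(1), `T`-joins)
[HansenJiangKlausen2025]; the disprover's findings `Cruxes/IndependentStrandsJoin/Disproof.lean` § A
(per-scale form TRUE; this file is its kernel-checked proof).
-/

noncomputable section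

open Finset SimpleGraph
open Literature.Probability.LatticeModels
open Literature.Combinatorics.SimpleGraph.CycleSpace
open Summit.CriticalPhenomena.Ising3DConformalLimit.Cruxes.ParityRobustMerging.PlaquetteXorSurgery
  (tetra tetra_inj tetra_injective tanh_criticalBeta_nonneg symmDiff_mem_tJoins)

namespace Summit.CriticalPhenomena.Ising3DConformalLimit.Theorems

namespace StubPerScale

/-! ### General finite graph: a `T`-join from two edge-disjoint paths; lifting walks -/

section General

variable {V : Type*} [Fintype V] [DecidableEq V] (G : SimpleGraph V) [DecidableRel G.Adj]

/-- The edge set of a simple path between two distinct vertices is a `T`-join of its endpoints. -/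
theorem toFinset_edges_mem_tJoins {u v : V} {p : G.Walk u v} (hp : p.IsPath) (huv : u ≠ v) :
    p.edges.toFinset ∈ tJoins G Set.univ {u, v} := by
  rw [mem_tJoins]
  refine ⟨fun e he => SimpleGraph.mem_edgeFinset.2 (p.edges_subset_edgeSet (List.mem_toFinset.1 he)),
    Set.subset_univ _, fun w => ?_⟩
  have h := odd_edgeDeg_walkEdges_iff hp huv w
  rw [edgeDeg, walkEdges] at h
  rw [h, Finset.mem_insert, Finset.mem_singleton]

/-- **A forcing set from two edge-disjoint paths.**  If `P : u → v` and `Q : v → w` are simple paths of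
`G` with disjoint edge sets and `u, v, w` are distinct, then `D = E(P) ∆ E(Q)` is a `T`-join of `{u, w}`
with `|D| ≤ |P| + |Q|` inside which `v` is joined to `u` (along `P`). -/
theorem forcingSet_of_paths {u v w : V} (P : G.Walk u v) (Q : G.Walk v w) (hP : P.IsPath)
    (hQ : Q.IsPath) (huv : u ≠ v) (hvw : v ≠ w) (huw : u ≠ w)
    (hdisj : Disjoint P.edges.toFinset Q.edges.toFinset) (m : ℕ) (hm : P.length + Q.length ≤ m) :
    ∃ D ∈ tJoins G Set.univ {u, w}, D.card ≤ m ∧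
      (SimpleGraph.fromEdgeSet (↑D : Set (Sym2 V))).Reachable v u := by
  have hDP : P.edges.toFinset ∈ tJoins G Set.univ {u, v} := toFinset_edges_mem_tJoins G hP huv
  have hDQ : Q.edges.toFinset ∈ tJoins G Set.univ {v, w} := toFinset_edges_mem_tJoins G hQ hvw
  have hpair : symmDiff ({u, v} : Finset V) {v, w} = {u, w} := by
    ext z
    simp only [Finset.mem_symmDiff, Finset.mem_insert, Finset.mem_singleton]
    constructor
    · rintro (⟨h1 | h1, h2⟩ | ⟨h1 | h1, h2⟩)
      · exact Or.inl h1
      · exact absurd (Or.inl h1) h2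
      · exact absurd (Or.inr h1) h2
      · exact Or.inr h1
    · rintro (rfl | rfl)
      · exact Or.inl ⟨Or.inl rfl, fun h => h.elim huv huw⟩
      · exact Or.inr ⟨Or.inr rfl, fun h => h.elim (fun h' => huw h'.symm) fun h' => hvw h'.symm⟩
  have hDmem : symmDiff P.edges.toFinset Q.edges.toFinset ∈ tJoins G Set.univ {u, w} := by
    have h := symmDiff_mem_tJoins G hDP hDQ
    rwa [hpair] at h
  refine ⟨_, hDmem, ?_, ?_⟩
  · calc #(symmDiff P.edges.toFinset Q.edges.toFinset)
        ≤ #P.edges.toFinset + #Q.edges.toFinset := card_symmDiff_le _ _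
      _ ≤ P.edges.length + Q.edges.length :=
          add_le_add (List.toFinset_card_le _) (List.toFinset_card_le _)
      _ ≤ m := by rwa [Walk.length_edges, Walk.length_edges]
  · have hPD : ∀ e ∈ P.edges, e ∈ (SimpleGraph.fromEdgeSet
        (↑(symmDiff P.edges.toFinset Q.edges.toFinset) : Set (Sym2 V))).edgeSet := by
      intro e he
      rw [SimpleGraph.edgeSet_fromEdgeSet]
      refine ⟨Finset.mem_coe.2 ?_, G.not_isDiag_of_mem_edgeSet (P.edges_subset_edgeSet he)⟩
      rw [Finset.mem_symmDiff]
      exact Or.inl ⟨List.mem_toFinset.2 he,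
        fun heQ => Finset.disjoint_left.1 hdisj (List.mem_toFinset.2 he) heQ⟩
    exact (P.transfer _ hPD).reachable.symm

omit [Fintype V] [DecidableEq V] [DecidableRel G.Adj] in
/-- A walk of `G` inside the vertex set `S` lifts to the graph `G.comap Subtype.val` on `↥S`, with the
same edges (through `Sym2.map Subtype.val`). -/
theorem exists_lift (S : Finset V) :
    ∀ {u v : V} (p : G.Walk u v) (hu : u ∈ S) (hv : v ∈ S), (∀ x ∈ p.support, x ∈ S) →
      ∃ q : (G.comap (Subtype.val : ↥S → V)).Walk ⟨u, hu⟩ ⟨v, hv⟩,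
        q.edges.map (Sym2.map Subtype.val) = p.edges := by
  intro u v p
  induction p with
  | nil => intro hu _ _; exact ⟨Walk.nil, rfl⟩
  | @cons x y z hadj p ih =>
    intro hx hz hsupp
    have hy : y ∈ S := hsupp y (by simp)
    obtain ⟨q, hq⟩ := ih hy hz fun w hw => hsupp w (by simp [hw])
    have hadj' : (G.comap (Subtype.val : ↥S → V)).Adj ⟨x, hx⟩ ⟨y, hy⟩ := hadj
    refine ⟨Walk.cons hadj' q, ?_⟩
    rw [Walk.edges_cons, Walk.edges_cons, List.map_cons, hq, Sym2.map_mk]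

end General

/-! ### Lattice geometry of `ℤ³`: straight legs, the two half-paths, the box -/

/-- A straight leg of `n` unit steps in the positive `i`-direction, as a walk of `ℤ³` from `u` to
`u + n • eᵢ`, with its length, vertices and edges. -/
theorem exists_leg (i : Fin 3) : ∀ (n : ℕ) (u v : Site 3), v = u + (n : ℤ) • Pi.single i 1 →
    ∃ p : (zdGraph 3).Walk u v, p.length = n ∧
      (∀ x ∈ p.support, ∃ k : ℕ, k ≤ n ∧ x = u + (k : ℤ) • Pi.single i 1) ∧
      (∀ e ∈ p.edges, ∃ k : ℕ, k < n ∧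
        e = s(u + (k : ℤ) • Pi.single i 1, u + ((k : ℤ) + 1) • Pi.single i 1)) := by
  intro n
  induction n with
  | zero =>
    intro u v hv
    rw [Nat.cast_zero, zero_smul, add_zero] at hv
    subst hv
    refine ⟨Walk.nil, rfl, fun x hx => ⟨0, le_rfl, ?_⟩, fun e he => ?_⟩
    · rw [Walk.support_nil, List.mem_singleton] at hx
      rw [hx, Nat.cast_zero, zero_smul, add_zero]
    · simp at he
  | succ n ih =>
    intro u v hv
    have hv' : v = (u + Pi.single i 1) + (n : ℤ) • Pi.single i 1 := by
      rw [hv, Nat.cast_succ, add_smul, one_smul]; abel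
    obtain ⟨p, hlen, hsupp, hedges⟩ := ih (u + Pi.single i 1) v hv'
    -- consecutive points of a coordinate line are neighbours (`zdGraph_adj_iff`)
    refine ⟨Walk.cons ((zdGraph_adj_iff _ _).2 ⟨i, Or.inl rfl⟩) p, by rw [Walk.length_cons, hlen],
      fun x hx => ?_, fun e he => ?_⟩
    · rw [Walk.support_cons, List.mem_cons] at hx
      rcases hx with rfl | hx
      · exact ⟨0, Nat.zero_le _, by rw [Nat.cast_zero, zero_smul, add_zero]⟩
      · obtain ⟨k, hk, rfl⟩ := hsupp x hx
        refine ⟨k + 1, by omega, ?_⟩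
        rw [Nat.cast_succ, add_smul, one_smul]; abel
    · rw [Walk.edges_cons, List.mem_cons] at he
      rcases he with rfl | he
      · refine ⟨0, Nat.succ_pos _, ?_⟩
        rw [Nat.cast_zero, zero_smul, add_zero, zero_add, one_smul]
      · obtain ⟨k, hk, rfl⟩ := hedges e he
        refine ⟨k + 1, by omega, ?_⟩
        rw [Nat.cast_succ]
        congr 1 <;> simp only [add_smul, one_smul] <;> abel

/-- Points of a straight segment between two points of `Λ_L` lie in `Λ_L`. -/
theorem segment_mem_box {L : ℕ} {u : Site 3} {i : Fin 3} {n k : ℕ} (hu : u ∈ box 3 L)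
    (hv : u + (n : ℤ) • Pi.single i 1 ∈ box 3 L) (hk : k ≤ n) :
    u + (k : ℤ) • Pi.single i 1 ∈ box 3 L := by
  rw [mem_box] at hu hv ⊢
  intro j
  have h1 := hu j
  have h2 := hv j
  simp only [Pi.add_apply, Pi.smul_apply, Pi.single_apply, smul_eq_mul] at h2 ⊢
  split_ifs at h2 ⊢ with hji
  · simp only [mul_one] at h2 ⊢
    constructor <;> omega
  · simp only [mul_zero, add_zero] at h2 ⊢
    exact h1

/-- The corners `(±l, ±l, ±l)` lie in `Λ_l`. -/
theorem vec_mem_box (l : ℕ) {x y z : ℤ} (hx : x = l ∨ x = -(l : ℤ)) (hy : y = l ∨ y = -(l : ℤ))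
    (hz : z = l ∨ z = -(l : ℤ)) : (![x, y, z] : Site 3) ∈ box 3 l := by
  rw [mem_box]
  intro j
  fin_cases j <;> simp <;> omega

/-- The three sources used by the forcing path, in coordinates. -/
theorem smul_tetra_eq (l : ℕ) :
    ((l : ℤ) • tetra 0 : Site 3) = ![-(l : ℤ), -(l : ℤ), -(l : ℤ)] ∧
    ((l : ℤ) • tetra 2 : Site 3) = ![(l : ℤ), -(l : ℤ), (l : ℤ)] ∧
    ((l : ℤ) • tetra 3 : Site 3) = ![-(l : ℤ), (l : ℤ), (l : ℤ)] := by
  refine ⟨?_, ?_, ?_⟩ <;> ext j <;> fin_cases j <;> simp [tetra]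

/-- The first half of the forcing path: `a₂ = (l,-l,l) → (-l,-l,l) → (-l,-l,-l) = a₀`, two straight
legs inside `Λ_l`, all of whose vertices have second coordinate `-l`. -/
theorem exists_pWalk (l : ℕ) (x y : Site 3) (hx : x = (l : ℤ) • tetra 2) (hy : y = (l : ℤ) • tetra 0) :
    ∃ p : (zdGraph 3).Walk x y, p.length = 4 * l ∧
      ∀ w ∈ p.support, w ∈ box 3 l ∧ w 1 = -(l : ℤ) := by
  obtain ⟨h0, h2, -⟩ := smul_tetra_eq l
  rw [h2] at hx
  rw [h0] at hy
  subst hx hy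
  have hA : (![(l : ℤ), -(l : ℤ), (l : ℤ)] : Site 3) =
      ![-(l : ℤ), -(l : ℤ), (l : ℤ)] + ((2 * l : ℕ) : ℤ) • Pi.single (0 : Fin 3) 1 := by
    ext j; fin_cases j <;> simp; ring
  have hB : (![-(l : ℤ), -(l : ℤ), (l : ℤ)] : Site 3) =
      ![-(l : ℤ), -(l : ℤ), -(l : ℤ)] + ((2 * l : ℕ) : ℤ) • Pi.single (2 : Fin 3) 1 := by
    ext j; fin_cases j <;> simp; ring
  have hc2 : (![(l : ℤ), -(l : ℤ), (l : ℤ)] : Site 3) ∈ box 3 l :=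
    vec_mem_box l (Or.inl rfl) (Or.inr rfl) (Or.inl rfl)
  have hc1 : (![-(l : ℤ), -(l : ℤ), (l : ℤ)] : Site 3) ∈ box 3 l :=
    vec_mem_box l (Or.inr rfl) (Or.inr rfl) (Or.inl rfl)
  have hc0 : (![-(l : ℤ), -(l : ℤ), -(l : ℤ)] : Site 3) ∈ box 3 l :=
    vec_mem_box l (Or.inr rfl) (Or.inr rfl) (Or.inr rfl)
  obtain ⟨A, hAl, hAs, -⟩ := exists_leg 0 (2 * l) _ _ hA
  obtain ⟨B, hBl, hBs, -⟩ := exists_leg 2 (2 * l) _ _ hB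
  refine ⟨A.reverse.append B.reverse, ?_, fun w hw => ?_⟩
  · rw [Walk.length_append, Walk.length_reverse, Walk.length_reverse, hAl, hBl]; ring
  · rw [Walk.mem_support_append_iff, Walk.support_reverse, Walk.support_reverse, List.mem_reverse,
      List.mem_reverse] at hw
    rcases hw with hw | hw
    · obtain ⟨k, hk, rfl⟩ := hAs w hw
      exact ⟨segment_mem_box hc1 (hA ▸ hc2) hk, by simp⟩
    · obtain ⟨k, hk, rfl⟩ := hBs w hw
      exact ⟨segment_mem_box hc0 (hB ▸ hc1) hk, by simp⟩

/-- The second half of the forcing path: `a₀ = (-l,-l,-l) → (-l,l,-l) → (-l,l,l) = a₃`, two straight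
legs inside `Λ_l`, every edge of which has an endpoint with second coordinate `≠ -l` (`l ≥ 1`). -/
theorem exists_qWalk (l : ℕ) (hl : 1 ≤ l) (x y : Site 3) (hx : x = (l : ℤ) • tetra 0)
    (hy : y = (l : ℤ) • tetra 3) :
    ∃ q : (zdGraph 3).Walk x y, q.length = 4 * l ∧ (∀ w ∈ q.support, w ∈ box 3 l) ∧
      ∀ e ∈ q.edges, ∃ w ∈ e, w 1 ≠ -(l : ℤ) := by
  obtain ⟨h0, -, h3⟩ := smul_tetra_eq l
  rw [h0] at hx
  rw [h3] at hy
  subst hx hy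
  have hC : (![-(l : ℤ), (l : ℤ), -(l : ℤ)] : Site 3) =
      ![-(l : ℤ), -(l : ℤ), -(l : ℤ)] + ((2 * l : ℕ) : ℤ) • Pi.single (1 : Fin 3) 1 := by
    ext j; fin_cases j <;> simp; ring
  have hE : (![-(l : ℤ), (l : ℤ), (l : ℤ)] : Site 3) =
      ![-(l : ℤ), (l : ℤ), -(l : ℤ)] + ((2 * l : ℕ) : ℤ) • Pi.single (2 : Fin 3) 1 := by
    ext j; fin_cases j <;> simp; ring
  have hc0 : (![-(l : ℤ), -(l : ℤ), -(l : ℤ)] : Site 3) ∈ box 3 l :=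
    vec_mem_box l (Or.inr rfl) (Or.inr rfl) (Or.inr rfl)
  have hc3 : (![-(l : ℤ), (l : ℤ), -(l : ℤ)] : Site 3) ∈ box 3 l :=
    vec_mem_box l (Or.inr rfl) (Or.inl rfl) (Or.inr rfl)
  have hc4 : (![-(l : ℤ), (l : ℤ), (l : ℤ)] : Site 3) ∈ box 3 l :=
    vec_mem_box l (Or.inr rfl) (Or.inl rfl) (Or.inl rfl)
  obtain ⟨C, hCl, hCs, hCe⟩ := exists_leg 1 (2 * l) _ _ hC
  obtain ⟨E, hEl, hEs, hEe⟩ := exists_leg 2 (2 * l) _ _ hE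
  refine ⟨C.append E, ?_, fun w hw => ?_, fun e he => ?_⟩
  · rw [Walk.length_append, hCl, hEl]; ring
  · rw [Walk.mem_support_append_iff] at hw
    rcases hw with hw | hw
    · obtain ⟨k, hk, rfl⟩ := hCs w hw
      exact segment_mem_box hc0 (hC ▸ hc3) hk
    · obtain ⟨k, hk, rfl⟩ := hEs w hw
      exact segment_mem_box hc3 (hE ▸ hc4) hk
  · rw [Walk.edges_append, List.mem_append] at he
    rcases he with he | he
    · obtain ⟨k, hk, rfl⟩ := hCe e he
      refine ⟨_, Sym2.mem_mk_right _ _, ?_⟩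
      simp; omega
    · obtain ⟨k, hk, rfl⟩ := hEe e he
      refine ⟨_, Sym2.mem_mk_left _ _, ?_⟩
      simp; omega

/-- **The forcing set.**  For `1 ≤ l ≤ N` and the sources `a = l • tetra` of the box `Λ_N`, there is a
`T`-join `D` of `{a₂, a₃}` in the box graph with at most `8l` edges inside which `a₀` is joined to
`a₂`: the edge set of a simple sub-path of the lattice path `a₂ → (-l,-l,l) → a₀` XOR that of a simple
sub-path of `a₀ → (-l,l,-l) → a₃` (the two are edge-disjoint: every vertex of the first has second
coordinate `-l`, every edge of the second has an endpoint off that plane). -/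
theorem exists_forcingSet {l N : ℕ} (hl : 1 ≤ l) (hN : l ≤ N) (a : Fin 4 → ↥(box 3 N))
    (ha : ∀ i, (a i : Site 3) = (l : ℤ) • tetra i) :
    ∃ D ∈ tJoins ((zdGraph 3).comap (Subtype.val : ↥(box 3 N) → Site 3)) Set.univ {a 2, a 3},
      D.card ≤ 8 * l ∧
      (SimpleGraph.fromEdgeSet (↑D : Set (Sym2 ↥(box 3 N)))).Reachable (a 0) (a 2) := by
  set G := (zdGraph 3).comap (Subtype.val : ↥(box 3 N) → Site 3) with hG
  have hinj := tetra_injective hl a ha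
  have h20 : a 2 ≠ a 0 := hinj.ne (by decide)
  have h03 : a 0 ≠ a 3 := hinj.ne (by decide)
  have h23 : a 2 ≠ a 3 := hinj.ne (by decide)
  have hlN : (l : ℤ) ≤ N := by exact_mod_cast hN
  have hbox : ∀ w : Site 3, w ∈ box 3 l → w ∈ box 3 N := fun w hw => by
    rw [mem_box] at hw ⊢
    intro j
    obtain ⟨h1, h2⟩ := hw j
    constructor <;> omega
  obtain ⟨p, hpl, hps⟩ := exists_pWalk l _ _ (ha 2) (ha 0)
  obtain ⟨q, hql, hqs, hqe⟩ := exists_qWalk l hl _ _ (ha 0) (ha 3)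
  obtain ⟨p', hp'⟩ : ∃ p' : G.Walk (a 2) (a 0), p'.edges.map (Sym2.map Subtype.val) = p.edges :=
    exists_lift (zdGraph 3) (box 3 N) p (a 2).2 (a 0).2 fun w hw => hbox w (hps w hw).1
  obtain ⟨q', hq'⟩ : ∃ q' : G.Walk (a 0) (a 3), q'.edges.map (Sym2.map Subtype.val) = q.edges :=
    exists_lift (zdGraph 3) (box 3 N) q (a 0).2 (a 3).2 fun w hw => hbox w (hqs w hw)
  -- simple sub-paths
  obtain ⟨P, hPpath, hPsub, hPlen⟩ : ∃ P : G.Walk (a 2) (a 0),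
      P.IsPath ∧ P.edges ⊆ p'.edges ∧ P.length ≤ p'.length :=
    ⟨p'.bypass, p'.bypass_isPath, p'.edges_bypass_subset_edges, p'.length_bypass_le_length⟩
  obtain ⟨Q, hQpath, hQsub, hQlen⟩ : ∃ Q : G.Walk (a 0) (a 3),
      Q.IsPath ∧ Q.edges ⊆ q'.edges ∧ Q.length ≤ q'.length :=
    ⟨q'.bypass, q'.bypass_isPath, q'.edges_bypass_subset_edges, q'.length_bypass_le_length⟩
  have hPe : ∀ e ∈ P.edges, ∀ w ∈ e, (w : Site 3) 1 = -(l : ℤ) := by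
    intro e he w hw
    have he' : Sym2.map Subtype.val e ∈ p.edges := by
      rw [← hp']; exact List.mem_map.2 ⟨e, hPsub he, rfl⟩
    have hw' : (w : Site 3) ∈ Sym2.map Subtype.val e := Sym2.mem_map.2 ⟨w, hw, rfl⟩
    exact (hps _ (mem_support_of_mem_walkEdges p (List.mem_toFinset.2 he') hw')).2
  have hQe : ∀ e ∈ Q.edges, ∃ w ∈ e, (w : Site 3) 1 ≠ -(l : ℤ) := by
    intro e he
    have he' : Sym2.map Subtype.val e ∈ q.edges := by
      rw [← hq']; exact List.mem_map.2 ⟨e, hQsub he, rfl⟩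
    obtain ⟨w', hw', hne⟩ := hqe _ he'
    obtain ⟨w, hw, rfl⟩ := Sym2.mem_map.1 hw'
    exact ⟨w, hw, hne⟩
  have hdisj : Disjoint P.edges.toFinset Q.edges.toFinset := by
    rw [Finset.disjoint_left]
    intro e heP heQ
    rw [List.mem_toFinset] at heP heQ
    obtain ⟨w, hw, hne⟩ := hQe e heQ
    exact hne (hPe e heP w hw)
  have hlen : P.length + Q.length ≤ 8 * l := by
    have hp'l : p'.length = p.length := by
      rw [← Walk.length_edges, ← Walk.length_edges, ← hp', List.length_map]
    have hq'l : q'.length = q.length := by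
      rw [← Walk.length_edges, ← Walk.length_edges, ← hq', List.length_map]
    calc P.length + Q.length ≤ p'.length + q'.length := add_le_add hPlen hQlen
      _ = 8 * l := by rw [hp'l, hq'l, hpl, hql]; ring
  exact forcingSet_of_paths G P Q hPpath hQpath h20 h03 h23 hdisj (8 * l) hlen

end StubPerScale

/-- **Registered stub `stub_perScale` of the skeleton `Lines/pinch_to_tetra.lean` (crux
`IndependentStrandsJoin`, stmt-CriticalPhenomena-14625) — the PER-SCALE crux** (signature verbatim: the
crux `IndependentStrandsJoin` with `∃ c` moved after `∀ l`; TRUE by finite energy): for every `l ≥ 1`,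
with `c(l) = (tanh² β_c / 2)^{8l}` and `N₀ = l`, forcing the `8l`-edge lattice path
`a₂ → a₀ → a₃` into the second strand joins `a₀` to `a₂` and costs at most the factor `c(l)`
(`StubPerScale.exists_forcingSet`, `StubPerScale.perScale_of_forcingSet`). -/
theorem stub_perScale :
    ∀ l : ℕ, 1 ≤ l → ∃ c : ℝ, 0 < c ∧ ∃ N₀ : ℕ, ∀ N : ℕ, N₀ ≤ N → ∀ a : Fin 4 → ↥(box 3 N),
      (∀ i, ((a i : Site 3)) = (l : ℤ) • tetra i) →
      c * loopO1PartitionFunction ((zdGraph 3).comap (Subtype.val : ↥(box 3 N) → Site 3))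
          (Real.tanh (criticalBeta 3)) {a 0, a 1} *
        loopO1PartitionFunction ((zdGraph 3).comap (Subtype.val : ↥(box 3 N) → Site 3))
          (Real.tanh (criticalBeta 3)) {a 2, a 3} ≤
      ∑ F₁ ∈ tJoins ((zdGraph 3).comap (Subtype.val : ↥(box 3 N) → Site 3)) Set.univ {a 0, a 1},
        ∑ F₂ ∈ tJoins ((zdGraph 3).comap (Subtype.val : ↥(box 3 N) → Site 3)) Set.univ {a 2, a 3},
          if (SimpleGraph.fromEdgeSet ((↑F₁ : Set (Sym2 ↥(box 3 N))) ∪ ↑F₂)).Reachable (a 0) (a 2)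
          then Real.tanh (criticalBeta 3) ^ (F₁.card + F₂.card) else 0 := by
  intro l hl
  have ht : 0 < Real.tanh (criticalBeta 3) := IndependentStrandsJoinNegative.tanh_criticalBeta_pos
  refine ⟨Real.tanh (criticalBeta 3) ^ (2 * (8 * l)) / 2 ^ (8 * l),
    div_pos (pow_pos ht _) (pow_pos two_pos _), l, fun N hN a ha => ?_⟩
  exact StubPerScale.perScale_of_forcingSet
    ((zdGraph 3).comap (Subtype.val : ↥(box 3 N) → Site 3)) (criticalBeta_nonneg 3) a (8 * l)
    (StubPerScale.exists_forcingSet hl hN a ha)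

end Summit.CriticalPhenomena.Ising3DConformalLimit.Theorems

end
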